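import Summits.QuantumFields.YangMills.Theorems.UnitScaleTiltHistoryTailIntEnvelopeRows
import Summits.QuantumFields.YangMills.Theorems.AlphaInputsT3ACv2RecHistories
import HarnessLib

/-!
# `UnitScaleTiltHistoryTailIntHistoriesRows` — THE F-2b `Rows` TWIN OF ✓`UnitScaleTiltHistoryTailIntHistories` OVER THE ROWS RECORD `AlphaInputsT3AC.PkgCoreRows` (✓`AlphaInputsT3ACv4CoreRows`; ★★OWNER RULING g26-№14 (F-2b),
# bill v1.2 §7 P7, ★alpha-2 g7 checklist (s1)–(s7)) — crux `HistoryTailL` (stmt-QuantumFields-19936), cell `ym3-torus`, width seat ym-ust-19936-w3 (g5)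

WHAT.  `UnitScaleTiltHistoryTailIntHistories`'s statements and proofs VERBATIM with `PkgCoreV3 ↦ PkgCoreRows` (the rows record carries the version-4 run rows `runRows : AlphaV4AC.RunAlphaV4CoreAC` —
currency-free (71) per recorded plaquette `h71` in place of the comb (67)-row — so `(q K).runCore ↦ (q K).runRows`); declaration names `PkgCoreV3.wtP_nonneg∕wtP_eq_zero_of_not_admissible∕integrable_wtP_and_integral_le ↦ PkgCoreRows.…`, `dataIntV3(P)_<row> ↦ dataIntRows(P)_<row>`, `lfDataIntV3_<row> ↦ lfDataIntRows_<row>`.  The cone thus runs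
over a FAMILY OF ROWS CORES `q : ∀ K, PkgCoreRows F 𝔠 γ hγ hγ1 K`, fed by the v3 cores (`PkgCoreV3.toRows`, by (69)–(71)) and by the v4 χ-package (`PkgAtV4Chi.toRows`).
THE ORIGINAL'S ACCOUNT (unchanged mathematics, names read with the substitutions above).  WHAT IS PROVED (given only a family `q : ∀ K, AlphaInputsT3AC.PkgCoreRows F 𝔠 γ hγ hγ1 K` of data cores, carrying its rows; nothing of [Balaban1985UV3] is asserted):
* §1 for the weights `wtP_j(r, ·)` of the core (`PkgCoreRows.wtP`): (w0) `wtP ≥ 0`; (w1) `wtP = 0` on inadmissible histories; (w2) `wtP_j(r, W) ≠ 0 ⇒ Adm K j r W` for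
  `1 ≤ j ≤ K`, pointwise; (e′) `Integrable (wtP_j r) ∧ ∫ wtP_j(r, ·) ≤ 1` uniformly in the cut-off; (e″) `Pint_j(r, ·)` measurable, `j ≤ K`.
* §2 `dataIntRowsP` (`dataIntRows` with `LF` split at the trivial history — the same function): `Ineq41AE` and `Integrable up` at every `j ≤ K`.
* §3 `lfDataIntRows`: `LFSum` PROVED, `LargeP` computed, the geometric half of `LargePSpec` PROVED (`lfDataIntRows_largeP_geom`).
The (40)-windowed weights do not read `χ`, so everything here is literally ★alpha-1's v3 text over the core.
HONEST FRAMING.  Bookkeeping twin (renaming + one field read); nothing of [Balaban1985UV3]'s cluster expansion or of [Balaban1985Variational] Thm 1 is proved; CONDITIONAL on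
the family of rows cores exactly as the original is on its cores; the v3-typed original stays in the tree unchanged (banked); count-neutral helper toward 2′χ
(`--supports stmt-QuantumFields-19936`); registry untouched.  YM₃ on the three-torus is rung R3 of the programme, not the Clay problem: nothing here is about d = 4,
infinite volume, or a mass gap.

References: T. Bałaban, Commun. Math. Phys. 102 (1985) 255–275 [Balaban1985UV3] ((1) p.256, (38)–(41) p.266, (47) p.267, (55) p.269, (67) p.273, Thm 2 p.272).
-/

set_option autoImplicit false

noncomputable section

namespace Summit.QuantumFields.YangMills.Theorems

open MeasureTheory
open scoped BigOperators
open Literature.MathematicalPhysics.QuantumFieldTheory.Balaban1983to89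
open Literature.MathematicalPhysics.QuantumFieldTheory.Balaban1983to89.T3ContinuumYM3Torus
open Literature.MathematicalPhysics.QuantumFieldTheory.Balaban1983to89.T3UnitLawDensityEML (ℰp)
open Literature.MathematicalPhysics.QuantumFieldTheory.Balaban1983to89.T3UnitScaleTilt (θBal)
open Literature.MathematicalPhysics.QuantumFieldTheory.Balaban1983to89.T3AlphaInputsAC
open Literature.MathematicalPhysics.QuantumFieldTheory.Balaban1983to89.T3AlphaInputsACSchemas
open Literature.MathematicalPhysics.QuantumFieldTheory.Balaban1983to89.B10Eq38TorusDomains (toFine cornerSet plaqsIn mem_plaqsIn_iff)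
open Literature.MathematicalPhysics.QuantumFieldTheory.Balaban1983to89.B10Eq42TorusConstraint (lam42 lam42_of_lt)
open Literature.MathematicalPhysics.QuantumFieldTheory.Balaban1985CMP102
open Literature.MathematicalPhysics.QuantumFieldTheory.Balaban1985CMP102.Setting
open Summit.QuantumFields.Balaban3D.Carriers
open Summit.QuantumFields.Balaban3D.Proofs.Primitives
open Summit.QuantumFields.Balaban3D.Proofs.TowerAC
open Summit.QuantumFields.Balaban3D.Proofs.StandardAC
open Summit.QuantumFields.Balaban3D.Proofs.InputsAC

open Classical

variable {F : T3Family} {𝔠 : AlphaConsts F.L (suGroupModel 2).N} {γ : ℝ} {hγ : 0 < γ} {hγ1 : γ ≤ (min 𝔠.gamma0 1) ^ 2}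
  (q : ∀ K, AlphaInputsT3AC.PkgCoreRows F 𝔠 γ hγ hγ1 K) (π : AlphaInputsT3AC.PolymerT3 F)

/-! ## §1 The clauses of the windowed pinned weights -/

/-- (w0) `wtP ≥ 0`. [folklore] -/
theorem AlphaInputsT3AC.PkgCoreRows.wtP_nonneg {K : ℕ} (p : AlphaInputsT3AC.PkgCoreRows F 𝔠 γ hγ hγ1 K) (j : ℕ) (r : Hist (F.P K) j) (W : GaugeField (F.P K) j (Matrix.specialUnitaryGroup (Fin 2) ℂ)) :
    0 ≤ p.wtP j r W :=
  (PinnedStep.wtP_nonneg_le 𝔠.lane p.X (AlphaInputsT3AC.admWindowT3 F 𝔠 γ hγ hγ1 K) j r W).1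

/-- (w1) `wtP = 0` on inadmissible histories. [folklore] -/
theorem AlphaInputsT3AC.PkgCoreRows.wtP_eq_zero_of_not_admissible {K : ℕ} (p : AlphaInputsT3AC.PkgCoreRows F 𝔠 γ hγ hγ1 K) (j : ℕ) (r : Hist (F.P K) j)
    (W : GaugeField (F.P K) j (Matrix.specialUnitaryGroup (Fin 2) ℂ))
    (hr : ¬ Hist.Admissible 𝔠.lane.carrier.M₁
      (rcolOf (T3Scales F γ hγ (hγ1.trans (sq_min_one_le _ 𝔠.gamma0_pos)) K) 𝔠.lane.carrier) j r) :
    p.wtP j r W = 0 :=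
  PinnedStep.wtP_eq_zero_of_not_admissible 𝔠.lane p.X (AlphaInputsT3AC.admWindowT3 F 𝔠 γ hγ hγ1 K) j r W hr

/-- **(w2) SUPPORT IN `Adm`, EVERY HISTORY, `1 ≤ j ≤ K`, POINTWISE**: `wtP_j(r, W) ≠ 0 ⇒ Adm K j r W` for the interior datum (`Adm = ChargedT3`: `r` admissible and `W` in
the (40) window under `Ω_j(r)` — the window sits INSIDE the weight). [cite: Balaban1985UV3, (40)–(41) p.266] -/
theorem AlphaInputsT3AC.dataIntRows_adm_of_wtP_ne_zero (K j : ℕ) (hj1 : 1 ≤ j) (hj : j ≤ K) (r : Hist (F.P K) j)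
    (W : GaugeField (F.P K) j (Matrix.specialUnitaryGroup (Fin 2) ℂ)) (hW : (q K).wtP j r W ≠ 0) :
    (AlphaInputsT3AC.dataIntRows q π).Adm K j r W := by
  obtain ⟨k, rfl⟩ : ∃ k, j = k + 1 := ⟨j - 1, by omega⟩
  obtain ⟨hmem, hadm⟩ := PinnedStep.mem_of_wtP_succ_ne_zero 𝔠.lane (q K).X (AlphaInputsT3AC.admWindowT3 F 𝔠 γ hγ hγ1 K) k r W hW
  refine ⟨hadm, ?_⟩
  have hKk : K - (k + 1) + 1 = K - k := by omega
  rw [hKk]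
  exact hmem

/-- **(e′) `wtP_j(r, ·)` IS INTEGRABLE WITH `∫ ≤ 1`, ALL `K, j, r` — UNIFORM IN THE CUT-OFF** (`PinnedStep.integrable_wtP_and_integral_le`). [cite: Balaban1985UV3, (41) p.266 + (48) p.267] -/
theorem AlphaInputsT3AC.PkgCoreRows.integrable_wtP_and_integral_le {K : ℕ} (p : AlphaInputsT3AC.PkgCoreRows F 𝔠 γ hγ hγ1 K) (j : ℕ) (r : Hist (F.P K) j) :
    Integrable (p.wtP j r) (fieldMeasure (F.P K) j (Matrix.specialUnitaryGroup (Fin 2) ℂ)) ∧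
      ∫ W, p.wtP j r W ∂fieldMeasure (F.P K) j (Matrix.specialUnitaryGroup (Fin 2) ℂ) ≤ 1 :=
  PinnedStep.integrable_wtP_and_integral_le 𝔠.lane p.X (AlphaInputsT3AC.admWindowT3 F 𝔠 γ hγ hγ1 K)
    (AlphaInputsT3AC.measurableSet_admWindowT3 F 𝔠 γ hγ hγ1 K) j r

/-- (e″) `Pint_j(r, ·)` of the datum is measurable for `j ≤ K` (data rows below the top, terminal row at the top). [cite: Balaban1985UV3, (43) p.266] -/
theorem AlphaInputsT3AC.dataIntRows_measurable_Pint (K j : ℕ) (hj : j ≤ K) (r : Hist (F.P K) j) :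
    Measurable fun W : GaugeField (F.P K) j (Matrix.specialUnitaryGroup (Fin 2) ℂ) => (AlphaInputsT3AC.dataIntRows q π).Pint K j r W :=
  (AlphaInputsT3AC.dataIntRows_dataRows q K j hj r).2.1

/-! ## §2 The datum with `LF` written as the stub writes it -/

/-- The majorant of `dataIntRowsP` is that of `dataIntRows` (`Finset.add_sum_erase`). [folklore] -/
theorem AlphaInputsT3AC.dataIntRowsP_up_eq (K j : ℕ) (W : GaugeField (F.P K) j (Matrix.specialUnitaryGroup (Fin 2) ℂ)) :
    (AlphaInputsT3AC.dataIntRowsP q π).up K j W = (AlphaInputsT3AC.dataIntRows q π).up K j W := by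
  show (q K).wtP j (Hist.triv (F.P K) j) W * Real.exp _ +
      ∑ r ∈ Finset.univ.erase (Hist.triv (F.P K) j), (q K).wtP j r W * Real.exp _ =
    ∑ r : Hist (F.P K) j, (q K).wtP j r W * Real.exp _
  exact Finset.add_sum_erase Finset.univ (fun r => (q K).wtP j r W *
    Real.exp (-((AlphaInputsT3AC.dataIntRows q π).mainT K j r W) + (AlphaInputsT3AC.dataIntRows q π).Pint K j r W + (AlphaInputsT3AC.dataIntRows q π).Zterm K j r))
    (Finset.mem_univ _)

/-- **(iv) `Ineq41AE` for `dataIntRowsP`, every `j ≤ K`.** [cite: Balaban1985UV3, (41) p.266 and Thm 2 p.272] -/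
theorem AlphaInputsT3AC.dataIntRowsP_ineq41AE (K j : ℕ) (hj : j ≤ K) : Ineq41AE (AlphaInputsT3AC.dataIntRowsP q π) K j := by
  unfold Ineq41AE
  filter_upwards [AlphaInputsT3AC.dataIntRows_ineq41AE q π K j hj] with W hW
  rw [AlphaInputsT3AC.dataIntRowsP_up_eq q π K j W]
  exact hW

/-- **(iv) `up_{dataIntRowsP}` integrable, every `j ≤ K`.** [folklore] -/
theorem AlphaInputsT3AC.dataIntRowsP_integrable_up (K j : ℕ) (hj : j ≤ K) :
    Integrable ((AlphaInputsT3AC.dataIntRowsP q π).up K j) (fieldMeasure (F.P K) j (Matrix.specialUnitaryGroup (Fin 2) ℂ)) := by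
  have hfun : (AlphaInputsT3AC.dataIntRowsP q π).up K j = (AlphaInputsT3AC.dataIntRows q π).up K j := funext fun W => AlphaInputsT3AC.dataIntRowsP_up_eq q π K j W
  rw [hfun]
  exact AlphaInputsT3AC.dataIntRows_integrable_up q π K j hj

/-! ## §3 The interface's `LFData`, `LFSum`, and the geometric half of `LargePSpec` -/

/-- The weight of `lfDataIntRows` is the windowed pinned weight (definitional). [cite: Balaban1985UV3, (41) p.266] -/
theorem AlphaInputsT3AC.lfDataIntRows_wt_eq (K j : ℕ) (r : Hist (F.P K) j)
    (v : (i : Fin j) → GaugeField (F.P K) i (Matrix.specialUnitaryGroup (Fin 2) ℂ)) (W : GaugeField (F.P K) j (Matrix.specialUnitaryGroup (Fin 2) ℂ)) :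
    (AlphaInputsT3AC.lfDataIntRows q π).wt K j r v W = (q K).wtP j r W := rfl

/-- The assembled history is the region history itself (definitional). [cite: Balaban1985UV3, (38) p.266] -/
theorem AlphaInputsT3AC.lfDataIntRows_assemble_eq (K j : ℕ) (r : Hist (F.P K) j)
    (v : (i : Fin j) → GaugeField (F.P K) i (Matrix.specialUnitaryGroup (Fin 2) ℂ)) :
    (AlphaInputsT3AC.lfDataIntRows q π).assemble K j r v = r := rfl

/-- **`LFSum` FOR THE INTERIOR DATUM — PROVED**: `wt ≥ 0`, the trivial region history assembles to the trivial history, and `LF_j(W)[Φ] = Σ_r ∫ wt(r, v, W)·e^{Φ(assemble r v)} dv`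
(integrand constant in the dummy fibre variable, `dv` a probability measure). [cite: Balaban1985UV3, (41) p.266] -/
theorem AlphaInputsT3AC.dataIntRows_lfSum : LFSum (AlphaInputsT3AC.dataIntRows q π) (AlphaInputsT3AC.lfDataIntRows q π) := by
  refine ⟨fun K j r v W => AlphaInputsT3AC.PkgCoreRows.wtP_nonneg (q K) j r W, fun K j v => rfl, fun K j W Φ => ?_⟩
  show ∑ r : Hist (F.P K) j, (q K).wtP j r W * Real.exp (Φ r) =
    ∑ r : Hist (F.P K) j, ∫ _v, (q K).wtP j r W * Real.exp (Φ r)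
      ∂Measure.pi fun i : Fin j => fieldMeasure (F.P K) (i : ℕ) (Matrix.specialUnitaryGroup (Fin 2) ℂ)
  refine Finset.sum_congr rfl fun r _ => ?_
  rw [integral_const, smul_eq_mul]
  simp

/-- The weight vanishes on inadmissible region histories. [cite: Balaban1985UV3, pp.267-268] -/
theorem AlphaInputsT3AC.lfDataIntRows_wt_eq_zero_of_not_admissible (K j : ℕ) (r : Hist (F.P K) j)
    (hr : ¬ Hist.Admissible 𝔠.lane.carrier.M₁
      (rcolOf (T3Scales F γ hγ (hγ1.trans (sq_min_one_le _ 𝔠.gamma0_pos)) K) 𝔠.lane.carrier) j r)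
    (v : (i : Fin j) → GaugeField (F.P K) i (Matrix.specialUnitaryGroup (Fin 2) ℂ)) (W : GaugeField (F.P K) j (Matrix.specialUnitaryGroup (Fin 2) ℂ)) :
    (AlphaInputsT3AC.lfDataIntRows q π).wt K j r v W = 0 :=
  AlphaInputsT3AC.PkgCoreRows.wtP_eq_zero_of_not_admissible (q K) j r W hr

/-- **The weight is supported in `Adm`** (`1 ≤ j ≤ K`, every region history, pointwise). [cite: Balaban1985UV3, (40)–(41) p.266] -/
theorem AlphaInputsT3AC.lfDataIntRows_adm_of_wt_ne_zero (K j : ℕ) (hj1 : 1 ≤ j) (hj : j ≤ K) (r : Hist (F.P K) j)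
    (v : (i : Fin j) → GaugeField (F.P K) i (Matrix.specialUnitaryGroup (Fin 2) ℂ)) (W : GaugeField (F.P K) j (Matrix.specialUnitaryGroup (Fin 2) ℂ))
    (hW : (AlphaInputsT3AC.lfDataIntRows q π).wt K j r v W ≠ 0) :
    (AlphaInputsT3AC.dataIntRows q π).Adm K j ((AlphaInputsT3AC.lfDataIntRows q π).assemble K j r v) W :=
  AlphaInputsT3AC.dataIntRows_adm_of_wtP_ne_zero q π K j hj1 hj r W hW

/-- `LargeP K j r i = ∅` for `j ≤ i`. [cite: Balaban1985UV3, (38) p.266] -/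
theorem AlphaInputsT3AC.lfDataIntRows_largeP_of_le (K j : ℕ) (r : Hist (F.P K) j) (i : ℕ) (hi : j ≤ i) :
    (AlphaInputsT3AC.lfDataIntRows q π).LargeP K j r i = ∅ := by
  dsimp only [AlphaInputsT3AC.lfDataIntRows]
  rw [dif_neg]
  exact fun hij => absurd hij.1 (not_lt.mpr hi)

/-- … and `∅` for inadmissible region histories. [cite: Balaban1985UV3, pp.267-268] -/
theorem AlphaInputsT3AC.lfDataIntRows_largeP_of_not_admissible (K j : ℕ) (r : Hist (F.P K) j)
    (hr : ¬ Hist.Admissible 𝔠.lane.carrier.M₁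
      (rcolOf (T3Scales F γ hγ (hγ1.trans (sq_min_one_le _ 𝔠.gamma0_pos)) K) 𝔠.lane.carrier) j r) (i : ℕ) :
    (AlphaInputsT3AC.lfDataIntRows q π).LargeP K j r i = ∅ := by
  dsimp only [AlphaInputsT3AC.lfDataIntRows]
  rw [dif_neg]
  exact fun hij => hr hij.2

/-- For an admissible region history and `i < j`, `LargeP K j r i = P_i(r)`. [cite: Balaban1985UV3, (38) p.266] -/
theorem AlphaInputsT3AC.lfDataIntRows_largeP_of_admissible (K j : ℕ) (r : Hist (F.P K) j)
    (hr : Hist.Admissible 𝔠.lane.carrier.M₁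
      (rcolOf (T3Scales F γ hγ (hγ1.trans (sq_min_one_le _ 𝔠.gamma0_pos)) K) 𝔠.lane.carrier) j r) (i : ℕ) (hi : i < j) :
    (AlphaInputsT3AC.lfDataIntRows q π).LargeP K j r i = r ⟨i, hi⟩ := by
  dsimp only [AlphaInputsT3AC.lfDataIntRows]
  rw [dif_pos ⟨hi, hr⟩]

/-- Below the top index the datum's `Λ_i(h)` IS the lane's `Carriers.Lam`. [cite: Balaban1985UV3, (40)-(42) p.266] -/
theorem AlphaInputsT3AC.dataIntRows_Λ_eq_Lam (K j : ℕ) (r : Hist (F.P K) j) (i : ℕ) (hi : i < j) :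
    (AlphaInputsT3AC.dataIntRows q π).Λ K j r i =
      Lam 𝔠.lane.carrier.M₁ (rcolOf (T3Scales F γ hγ (hγ1.trans (sq_min_one_le _ 𝔠.gamma0_pos)) K) 𝔠.lane.carrier) r i := by
  show lam42 _ j i = _
  rw [lam42_of_lt hi]
  rfl

/-- **`LargePSpec`, GEOMETRIC HALF, FOR `lfDataIntRows` — PROVED**: `p′ ∈ LargeP K j r i`, `j ≤ K` ⇒ `i < j` and `p′ ∈ plaqsIn i (Λ_i(assemble r v))`.
[cite: Balaban1985UV3, (67) p.273] -/
theorem AlphaInputsT3AC.lfDataIntRows_largeP_geom (K j : ℕ) (hj : j ≤ K) (r : Hist (F.P K) j)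
    (v : (i : Fin j) → GaugeField (F.P K) i (Matrix.specialUnitaryGroup (Fin 2) ℂ)) (i : ℕ) (p' : Plaq (F.P K) i)
    (hp : p' ∈ (AlphaInputsT3AC.lfDataIntRows q π).LargeP K j r i) :
    i < j ∧ p' ∈ plaqsIn i ((AlphaInputsT3AC.dataIntRows q π).Λ K j ((AlphaInputsT3AC.lfDataIntRows q π).assemble K j r v) i) := by
  by_cases hij : i < j ∧ Hist.Admissible 𝔠.lane.carrier.M₁
      (rcolOf (T3Scales F γ hγ (hγ1.trans (sq_min_one_le _ 𝔠.gamma0_pos)) K) 𝔠.lane.carrier) j r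
  · rw [AlphaInputsT3AC.lfDataIntRows_largeP_of_admissible q π K j r hij.2 i hij.1] at hp
    refine ⟨hij.1, ?_⟩
    rw [AlphaInputsT3AC.lfDataIntRows_assemble_eq q π, AlphaInputsT3AC.dataIntRows_Λ_eq_Lam q π K j r i hij.1, mem_plaqsIn_iff]
    have hiK : i ≤ (F.P K).m + (F.P K).K := by
      show i ≤ F.m + K
      omega
    exact (cornerSet_subset_plaqCover hiK p').trans (plaqCover_subset_Lam_of_admissible _ _ j r hij.2 i hij.1 p' hp)
  · exfalso
    have h0 : (AlphaInputsT3AC.lfDataIntRows q π).LargeP K j r i = ∅ := by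
      dsimp only [AlphaInputsT3AC.lfDataIntRows]
      rw [dif_neg hij]
    rw [h0] at hp
    simp at hp

end Summit.QuantumFields.YangMills.Theorems

end
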